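import Literature.NumberTheory.LFunctions.Xiao2020.KeiperLiTaylor
import Literature.NumberTheory.LFunctions.RosserSchoenfeldMertensFirstConstantCorollaries
import Mathlib.NumberTheory.LSeries.Deriv
import HarnessLib

/-!
# RH-FREE: the arithmetic (prime-power) formula for the Taylor coefficients of `ζ₁'/ζ₁` at `s = 1`

Topic `Literature/NumberTheory/LFunctions` (siblings: `Xiao2020/KeiperLiTaylor.lean` — the coefficients
`q_k = (ζ₁'/ζ₁)^{(k)}(1)/k!` (`zetaOneLogDerivCoeff`), `ζ₁(s) = (s−1)ζ(s)`; `ZetaLogDerivTaylorLaw.lean` —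
their law `q_k = (−1)^k Σ_{m odd ≥ 3} m^{−(k+1)} + O(13^{−k})`; `KeiperLiTrend.lean` — the oscillating
part `S_n = Σ_{j<n} C(n,j+1) Re q_j` of the Keiper–Li coefficients).  Everything here is PROVED; no
definitions, no named facts (**RH-FREE**).

Bombieri–Lagarias (1999, Thm. 2) and Coffey (2010, eq. (5)) express the coefficients
`η_k = −q_k` of `−ζ'/ζ(s) = 1/(s−1) + Σ_k η_k (s−1)^k` through the prime powers:
`η_k = ((−1)^k/k!) lim_{x→∞} (Σ_{m≤x} Λ(m) (log m)^k/m − (log x)^{k+1}/(k+1))`.  This file proves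

* `iteratedDeriv_logDeriv_riemannZeta₁_eq` — on `Re s > 1`:
  `(ζ₁'/ζ₁)^{(k)}(s) = (−1)^k k!/(s−1)^{k+1} − (−1)^k Σ_n Λ(n)(log n)^k n^{−s}`
  (termwise differentiation of `−ζ'/ζ = Σ Λ(n) n^{−s}`, Mathlib's `LSeries_iteratedDeriv`);
* `tendsto_LSeries_vonMangoldt_logPow_sub` — the ABELIAN form of the arithmetic formula, for every `k`:
  `Σ_n Λ(n)(log n)^k n^{−s} − k!/(s−1)^{k+1} → (−1)^{k+1} k! q_k = (−1)^k k! η_k` as `s → 1` in `Re s > 1`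
  (and along the reals, `tendsto_LSeries_vonMangoldt_logPow_sub_real`), since `ζ₁'/ζ₁` is analytic
  at `1`;
* `zetaOneLogDerivCoeff_zero` — `q_0 = γ`, and the printed `x → ∞` form at `k = 0`,
  `Σ_{n≤x} Λ(n)/n − log x → η_0 = −γ` (`tendsto_sum_vonMangoldt_div_sub_log_eta_zero`, from the tree's
  Mertens theorem with constant, `tendsto_sum_vonMangoldt_div_sub_log`).

-- TODO(general form): the `x → ∞` partial-sum form of (5) for `k ≥ 1` (partial summation against the
-- tree's `chebyshevPsi_sub_self_isBigO_div_logPow`) is not done here; only the Abelian `s → 1⁺` form.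

## References

* E. Bombieri, J. C. Lagarias, *Complements to Li's criterion for the Riemann hypothesis*, J. Number
  Theory 77 (1999), 274–287, Thm. 2. [BombieriLagarias1999]
* M. W. Coffey, *The Stieltjes constants, their relation to the `η_j` coefficients, and representation
  of the Hurwitz zeta function*, Analysis 30 (2010), 383–409, eqs. (3), (5) (arXiv:0706.0343, held:
  `paper:arxiv-0706.0343`, p. 2). [Coffey2010Eta]
-/

noncomputable section

open Complex Filter Topology Set Metric Finset LSeries
open scoped Nat LSeries.notation ArithmeticFunction.vonMangoldt

namespace Literature.NumberTheory.LFunctions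

/-- `logMul^[k] f = (log ·)^k · f`. [folklore] -/
private theorem logMul_iterate (f : ℕ → ℂ) (k : ℕ) :
    LSeries.logMul^[k] f = fun n : ℕ ↦ (Complex.log (n : ℂ)) ^ k * f n := by
  induction k with
  | zero => funext n; simp
  | succ k ih =>
    funext n
    rw [Function.iterate_succ_apply', ih]
    simp only [LSeries.logMul]
    ring

/-- The abscissa of absolute convergence of `Σ Λ(n) n^{−s}` is at most `1`. [folklore] -/
private theorem abscissaOfAbsConv_vonMangoldt_le_one : abscissaOfAbsConv ↗Λ ≤ 1 :=
  LSeries.abscissaOfAbsConv_le_of_forall_lt_LSeriesSummable fun y hy ↦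
    ArithmeticFunction.LSeriesSummable_vonMangoldt (by simpa using hy)

/-- **The derivatives of `ζ₁'/ζ₁` on `Re s > 1`**:
`(ζ₁'/ζ₁)^{(k)}(s) = (−1)^k k!/(s−1)^{k+1} − (−1)^k Σ_n Λ(n) (log n)^k n^{−s}`
(`ζ₁'/ζ₁ = 1/(s−1) − Σ Λ(n)n^{−s}` there, differentiated termwise). [cite: Coffey2010Eta, eqs. (3), (6)] -/
theorem iteratedDeriv_logDeriv_riemannZeta₁_eq {s : ℂ} (hs : 1 < s.re) (k : ℕ) :
    iteratedDeriv k (logDeriv riemannZeta₁) s =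
      (-1) ^ k * (k ! : ℂ) * ((s - 1) ^ (k + 1))⁻¹ -
        (-1) ^ k * LSeries (fun n ↦ (Complex.log n) ^ k * ↗Λ n) s := by
  have hopen : IsOpen {z : ℂ | 1 < z.re} := isOpen_lt continuous_const Complex.continuous_re
  have hev : logDeriv riemannZeta₁ =ᶠ[𝓝 s] fun z ↦ (z - 1)⁻¹ - L ↗Λ z := by
    filter_upwards [hopen.mem_nhds hs] with z hz
    rw [logDeriv_riemannZeta₁_eq_of_one_lt_re hz, one_div]
  have hs1 : s ≠ 1 := fun h ↦ by rw [h] at hs; simp at hs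
  have habs : abscissaOfAbsConv ↗Λ < s.re :=
    lt_of_le_of_lt abscissaOfAbsConv_vonMangoldt_le_one (by exact_mod_cast hs)
  have h1 : ContDiffAt ℂ k (fun z : ℂ ↦ (z - 1)⁻¹) s := (contDiffAt_id.sub contDiffAt_const).inv
    (sub_ne_zero.2 hs1)
  have h2 : ContDiffAt ℂ k (LSeries ↗Λ) s :=
    ((LSeries_differentiableOn ↗Λ).analyticAt ((isOpen_re_gt_EReal _).mem_nhds habs)).contDiffAt
  rw [hev.iteratedDeriv_eq, iteratedDeriv_fun_sub h1 h2,
    Literature.Analysis.Complex.iteratedDeriv_inv_sub_const 1 k s, LSeries_iteratedDeriv k habs,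
    logMul_iterate]

/-- `q_0 = ζ₁'/ζ₁(1) = γ` (`ζ₁(1) = 1`, `ζ₁'(1) = γ`). [folklore] -/
private theorem zetaOneLogDerivCoeff_zero :
    Xiao2020.zetaOneLogDerivCoeff 0 = (Real.eulerMascheroniConstant : ℂ) := by
  unfold Xiao2020.zetaOneLogDerivCoeff
  rw [iteratedDeriv_zero, logDeriv_apply, deriv_riemannZeta₁_one, riemannZeta₁_one]
  simp

/-- The iterated derivative of a function analytic at a point is analytic there. [folklore] -/
private theorem analyticAt_iteratedDeriv {f : ℂ → ℂ} {z : ℂ} (hf : AnalyticAt ℂ f z) (k : ℕ) :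
    AnalyticAt ℂ (iteratedDeriv k f) z := by
  induction k with
  | zero => simpa using hf
  | succ k ih => rw [iteratedDeriv_succ]; exact ih.deriv

/-- **RH-FREE. The arithmetic formula for `η_k = −q_k`, Abelian form** (Bombieri–Lagarias Thm. 2;
Coffey 2010 (5): `η_k = ((−1)^k/k!) lim (Σ_{m≤x} Λ(m)(log m)^k/m − (log x)^{k+1}/(k+1))`): for every
`k`, as `s → 1` within `Re s > 1`,

  `Σ_n Λ(n) (log n)^k n^{−s} − k!/(s−1)^{k+1} ⟶ (−1)^{k+1} k! · q_k  (= (−1)^k k! η_k)`.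

-- TODO(general form): the printed statement is the `x → ∞` limit of the partial sums; here the
-- Abelian (`s → 1⁺`) limit, which follows from the analyticity of `ζ₁'/ζ₁` at `1`.
[cite: Coffey2010Eta, eq. (5)] -/
theorem tendsto_LSeries_vonMangoldt_logPow_sub (k : ℕ) :
    Tendsto (fun s : ℂ ↦ LSeries (fun n ↦ (Complex.log n) ^ k * ↗Λ n) s - (k ! : ℂ) * ((s - 1) ^ (k + 1))⁻¹)
      (𝓝[{s : ℂ | 1 < s.re}] 1) (𝓝 ((-1) ^ (k + 1) * (k ! : ℂ) * Xiao2020.zetaOneLogDerivCoeff k)) := by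
  have han := analyticAt_iteratedDeriv Xiao2020.analyticAt_logDeriv_riemannZeta₁_one k
  have hcont : Tendsto (fun s ↦ (-1) ^ (k + 1) * iteratedDeriv k (logDeriv riemannZeta₁) s)
      (𝓝[{s : ℂ | 1 < s.re}] 1) (𝓝 ((-1) ^ (k + 1) * iteratedDeriv k (logDeriv riemannZeta₁) 1)) :=
    ((han.continuousAt.tendsto).const_mul _).mono_left nhdsWithin_le_nhds
  have hval : (-1) ^ (k + 1) * iteratedDeriv k (logDeriv riemannZeta₁) 1 =
      (-1) ^ (k + 1) * (k ! : ℂ) * Xiao2020.zetaOneLogDerivCoeff k := by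
    have hfk : (k ! : ℂ) ≠ 0 := by exact_mod_cast Nat.factorial_ne_zero k
    unfold Xiao2020.zetaOneLogDerivCoeff
    field_simp
  rw [hval] at hcont
  refine hcont.congr' ?_
  filter_upwards [self_mem_nhdsWithin] with s hs
  rw [iteratedDeriv_logDeriv_riemannZeta₁_eq hs]
  have h : (-1 : ℂ) ^ (k + 1) * (-1) ^ k = -1 := by
    rw [← pow_add, show k + 1 + k = 2 * k + 1 by ring, pow_succ, pow_mul]; norm_num
  linear_combination ((k ! : ℂ) * ((s - 1) ^ (k + 1))⁻¹ -
    LSeries (fun n ↦ (Complex.log n) ^ k * ↗Λ n) s) * h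

/-- The same along the real axis: `Σ_n Λ(n)(log n)^k n^{−σ} − k!/(σ−1)^{k+1} → (−1)^{k+1} k! q_k` as
`σ → 1⁺`. [cite: Coffey2010Eta, eq. (5)] -/
theorem tendsto_LSeries_vonMangoldt_logPow_sub_real (k : ℕ) :
    Tendsto (fun σ : ℝ ↦ LSeries (fun n ↦ (Complex.log n) ^ k * ↗Λ n) σ -
        (k ! : ℂ) * (((σ : ℂ) - 1) ^ (k + 1))⁻¹)
      (𝓝[>] 1) (𝓝 ((-1) ^ (k + 1) * (k ! : ℂ) * Xiao2020.zetaOneLogDerivCoeff k)) := by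
  have hmap : Tendsto ((↑) : ℝ → ℂ) (𝓝[>] (1 : ℝ)) (𝓝[{s : ℂ | 1 < s.re}] 1) := by
    have h := (Complex.continuous_ofReal.continuousWithinAt (s := Ioi (1 : ℝ)) (x := 1)).tendsto_nhdsWithin
      (t := {s : ℂ | 1 < s.re}) (fun x hx ↦ by simpa using hx)
    simpa using h
  exact (tendsto_LSeries_vonMangoldt_logPow_sub k).comp hmap

/-- **The printed form at `k = 0`**: `Σ_{n ≤ x} Λ(n)/n − log x → η_0 = −q_0 = −γ` as `x → ∞`
(Mertens' theorem with its constant, the tree's `tendsto_sum_vonMangoldt_div_sub_log`).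
[cite: Coffey2010Eta, eq. (5)] -/
theorem tendsto_sum_vonMangoldt_div_sub_log_eta_zero :
    Tendsto (fun x : ℝ ↦ ∑ n ∈ Finset.Ioc 0 ⌊x⌋₊, (Λ n : ℝ) / n - Real.log x) atTop
      (𝓝 (-(Xiao2020.zetaOneLogDerivCoeff 0).re)) := by
  rw [zetaOneLogDerivCoeff_zero, Complex.ofReal_re]
  exact tendsto_sum_vonMangoldt_div_sub_log

end Literature.NumberTheory.LFunctions
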